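import Literature.MathematicalPhysics.QuantumFieldTheory.Balaban1983to89.B12Transverse536
import Literature.MathematicalPhysics.QuantumFieldTheory.Balaban1983to89.B12Rep526

/-!
# `Balaban1983to89.B12Rep526Coeff` — [Balaban1987RG1] §5 pp. 294–295: (5.22)–(5.29) on the COEFFICIENT side —
the pieces `g^ε` of (5.22) as the printed restricted sums of (5.29), the normalisations (5.23)/(5.24), (5.25) and
the representation (5.26) from (5.13), and the printed directions (5.18) ⇒ (5.27), (5.20) ⇒ (5.28), reality of `g`

HONEST FRAMING (cell `lit-balaban`, verbatim): statement-level skeleton of published theorems with citation tags;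
proofs where landed; nothing here is a claim about the Yang–Mills mass gap.

CITATION HEADER.  T. Bałaban, *Renormalization group approach to lattice gauge field theories. I. Generation of
effective actions in a small field approximation and a coupling constant renormalization in four dimensions*,
Commun. Math. Phys. **109** (1987) 249–301, doi:10.1007/bf01215223 [Balaban1987RG1] (cell paper B12).
PDF held: `paper:balaban1987-cmp109-rg-i-small-field` (journal page = PDF page + 248; the displays (5.17)–(5.31) were
read as images from the page renders `b2b-balaban-ref1/pages/1987-cmp109-rg-I-small-field/…-p046-x2.png` (p. 294)
and `…-p047-x2.png` (p. 295)).  Unit `lit-balaban-r09` gen 3 (reader/typer of B12), HOME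
`run/shared/lean/pub/lit-balaban/`; WHAT IS REPRODUCED = SKELETON rows `B12.Eq5.22-5.26` and `B12.Eq5.27-5.29` — the
d-variable, coefficient-side assembly that the two earlier files of these rows leave open: r09's `B12Rep526`
(general-`d` FORM of (5.26) and the directions (5.27) ⇒ (5.18), (5.28) ⇒ (5.20); its header: «NOT typed here: the
converse implications … and (5.29)») and p10's `B12LaurentSplitting522Proof` (ONE complex variable: existence /
uniqueness of the splitting and the three normalised cases; its header: «NOT HERE: the d-variable bookkeeping …
(5.27)–(5.29)»).  Pre-existing carriers, imported BY NAME (nothing re-declared): `PeriodicGleason.zpowv/genFun/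
ExpBound/wt/PolyAnnulus` (Laurent series with exponentially decaying coefficients, [GawedzkiKupiainen1985] App. 2 =
B12's ref. [43]: p. 294 «It was used already in [43] for a similar purpose»), `B12Beta.Kernel/PermCovariant`
((1.21)/(5.12)), `B12Transverse536.ReflCovariant/reflTwist/rsgn` ((5.7)/(5.13)), `B12Rep526.sgn/low/twist/permZ/
rep526/gEps/eq522` ((5.25)/(5.26)).

WHAT IS PRINTED (verbatim, pp. 294–295).  (5.17) *«f_{μν}(z₁,…,z_d) = Π_{μν}((1/i) log z₁, …, (1/i) log z_d),
e^{−δ₁} < |z_μ| < e^{δ₁}»*; (5.18)–(5.20) *«f_{μν}(rz) = ((r⊗r)f)_{μν}(z) if r is a permutation, f_{μν}(z^ε) =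
ε_με_ν z_μ^{−(1−ε_μ)/2} z_ν^{(1−ε_ν)/2} f_{μν}(z) [here z^ε = (z₁^{ε₁},…,z_d^{ε_d})], f_{μν}(z) = f_{νμ}(z⁻¹)»*.
p. 294: *«Now, a given function f(z) analytic on the ring {e^{−δ₁} < |z| < e^{δ₁}} can be represented as f(z) =
g⁺(z) + g⁻(z⁻¹) … This representation is obtained by taking regular and singular parts of the Laurent expansion. It
is unique up to an additive constant, and it can be made unique requiring some normalization conditions. … If the
index of this component is different from μ, ν, then … The normalization condition g⁺(0) = g⁻(0) implies then g⁻(z)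
= g⁺(z) … If the index is equal to μ, then … The normalization condition g⁺(0) = 0 implies g⁻(z) = −z⁻¹g⁺(z) …
Finally, if the index is equal to ν, then … the normalization condition g⁻(0) = 0 implies g⁻(z) = −zg⁺(z) …
Applying these representations to the functions f_{μν}(z), to each variable separately, we obtain
    f_{μν}(z) = Σ_ε g^ε_{μν}(z^ε),   (5.22)
where the functions g^ε_{μν}(z) are analytic on the polydisc ×_μ{|z_μ| < e^{δ₁}}. They satisfy the normalization
conditions: g^{(ε′,ε_λ=+1,ε″)}_{μν}(z′,0,z″) = g^{(ε′,ε_λ=−1,ε″)}_{μν}(z′,0,z″)  (5.23) for the indices λ different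
from μ, ν, if μ ≠ ν, or for all the indices λ, if μ = ν; g^{(ε′,ε_μ=+1,ε″)}_{μν}(z′,0,z″) =
g^{(ε′,ε_μ=−1,ε″)}_{μν}(z′,0,z″) = 0, (5.24) if μ ≠ ν. These normalization conditions and the transformation laws
(5.19) imply the equalities g^ε_{μν}(z) = ε_με_ν z_μ^{−(1−ε_μ)/2} z_ν^{(1−ε_ν)/2} g^{(+1,…,+1)}_{μν}(z). (5.25)
Denoting g_{μν}(z) = g^{(+1,…,+1)}_{μν}(z), we get the following representation:
    f_{μν}(z) = Σ_ε ε_με_ν z_μ^{(1−ε_μ)/2} z_ν^{−(1−ε_ν)/2} g_{μν}(z^ε).   (5.26)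
Let us now write properties of the functions g_{μν}(z) equivalent to the properties (5.18)–(5.20). The equalities
(5.18) are equivalent to g_{μν}(rz) = ((r⊗r)g)_{μν}(z) if r is a permutation. (5.27) The equalities (5.19) are
implied by the form of the representation (5.26). The equalities (5.20) are equivalent to g_{μν}(z) =
z_ν⁻¹z_μ g_{νμ}(z). (5.28) From the definition of the function f_{μν}(z), we have also the following representation:
    f_{μν}(z) = Σ_{x∈Z^d} z^{−x} Π_{μν}(x),   (5.29)
hence the terms of the representation (5.22) are obtained by restricting correspondingly the range of the summation
in (5.29). This implies that all these terms, and in particular the function g_{μν}(z), are real functions for real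
variables z.»*

HOW IT IS FORMALIZED (coefficient side; `c : Fin d → Fin d → ℤ^d → ℂ` a family of Laurent coefficients, the paper's
`Π_{μν}(x)`; a real B12 kernel `P : B12Beta.Kernel d` enters through `castK P`).
* §1 (5.29)/(5.17): `f529 c μ ν z = Σ'_x c_{μν}(x) z^{−x}` (`= genFun (c μ ν) z⁻¹`, `f529_eq_genFun`); absolute
  convergence on the closed poly-annuli `e^{−b} ≤ |z_j| ≤ e^{b}`, `b < a`, for `a`-decaying coefficients
  (`summable_norm_f529` — (5.10) is `ExpBound δ₁`).
* §2 the ONE-COORDINATE WEIGHTS of the printed splitting (p. 294): in a coordinate different from μ, ν (or any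
  coordinate if μ = ν) the term `z^{−n}` of (5.29) goes to `g⁺` for `n < 0`, to `g⁻` for `n > 0`, and is HALVED between
  them for `n = 0` (this is `g⁺(0) = g⁻(0)`); in the coordinate μ (μ ≠ ν) `n < 0` goes to `g⁺`, `n ≥ 0` to `g⁻`
  (`g⁺(0) = 0`); in the coordinate ν `n ≤ 0` to `g⁺`, `n > 0` to `g⁻` (`g⁻(0) = 0`): `w1`, `wgt μ ν ε x =
  Π_κ w1(role κ)(ε_κ)(x_κ)`, `sum_wgt : Σ_ε wgt μ ν ε x = 1`.
* §3 THE PIECES: `piece c μ ν ε w = Σ'_x wgt μ ν ε x · c_{μν}(x) · w^{−εx}` — a power series in `w` (exponents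
  `−ε_κx_κ ≥ 0` on the support of the weight, `exponent_nonneg_of_wgt_ne_zero`); **`eq529_restricted`**: `g^ε(z^ε) =
  Σ'_x wgt(ε,x) c(x) z^{−x}` = «(5.29) with the range of summation restricted»; **`eq522`**: `f = Σ_ε g^ε(z^ε)`
  (PROVED wherever the series (5.29) converges absolutely; `eq522_polyAnnulus` on the poly-annulus); «analytic on the
  polydisc»: `summable_norm_piece`/`norm_piece_le` = absolute convergence of the power series of every `g^ε` on every
  closed polydisc `|w_j| ≤ e^{b}`, `b < a` (the `AnalyticOnNhd` packaging in `d` variables is not done here).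
* §4 (5.23) `eq523` and (5.24) FIRST member `eq524_mu` PROVED for these pieces; the prose's «g⁻(0) = 0 for the index
  ν» is `eq524_nu` (the `ε_ν = −1` piece vanishes at `z_ν = 0`).  LOCATED READING NOTE on (5.24) (flagged, not
  adjudicated, by p10's header): the render prints the subscript `ε_μ` in BOTH members of (5.24); the second member
  so read — «the `ε_μ = −1` piece vanishes at `z_μ = 0`» — is FALSE for the printed construction whenever
  `Π_{μν}(0) ≠ 0` (`piece_zero`, `wgt_zero_ne_zero`, **`not_eq524_second_member`**; e.g. the leading term
  `−β(z_μ⁻¹ − 1)(z_ν − 1)` of Bałaban's own (5.36) has `Π_{μν}(0) = −β`), consistent with (5.25): for `ε_μ = −1`,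
  `g^ε = −z_μ⁻¹ ⋯ g` has the value `−∂_μ g` at `z_μ = 0`; the displayed condition that holds is the ν-one.
* §5 (5.25) **`eq525`** from the coefficient form `Cov519` of (5.19) (= (5.13); `cov519_of_reflCovariant` derives it
  for every sign vector from the tree's single-axis `B12Transverse536.ReflCovariant`), at every point with non-zero
  coordinates (the factor `z_μ^{−1}`); (5.26) **`eq526`**: `f529 c = rep526 (gRep c)` with `gRep c = g^{(+1,…,+1)}` —
  so r09's `B12Rep526.eq519_of_rep526/eq518_of_eq527/eq520_of_eq528` now apply to the `f`, `g` OF THE PAPER.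
* §6 (5.27) **`eq527`** from (5.12) (`B12Beta.PermCovariant`, complex form `Perm512`), and (5.18) `eq518` for `f529`;
  §7 (5.28) **`eq528`** from (5.14) `Sym514` + (5.13) at `ε = (−1,…,−1)`, and (5.20) `eq520` for `f529`;
  §8 reality **`gRep_im_eq_zero`**/`piece_ofReal` for a real kernel at real points.
WHAT IS NOT HERE: the abstract «equivalent» for an ARBITRARY pair (f, g) related by (5.26) (it needs uniqueness of
Laurent coefficients in `d` variables; one variable: `B12LaurentSplitting522Proof.laurent_splitting_unique`) — the
paper itself identifies `g` with the restricted sum, and for that `g` both sides of each equivalence are proved;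
(5.21) in terms of `g` («much simpler … later on»).  No `Prop` fact, no `sorry`; every theorem kernel-checked;
axioms standard.
-/

namespace Literature.MathematicalPhysics.QuantumFieldTheory.Balaban1983to89.B12Rep526Coeff

noncomputable section

open Literature.MathematicalPhysics.QuantumFieldTheory.GawedzkiKupiainen1985.PeriodicGleason
open Literature.MathematicalPhysics.QuantumFieldTheory.Balaban1983to89.B12Rep526
open Finset

variable {d : ℕ}

/-! ## §0. Units of `ℤ` (sign vectors `ε`) — bookkeeping -/

/-- `(−1 : ℤˣ) ≠ 1`. [folklore] -/
private theorem neg_one_ne_one_U : (-1 : ℤˣ) ≠ 1 := by decide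

/-- `(1 : ℤˣ) ≠ −1`. [folklore] -/
private theorem one_ne_neg_one_U : (1 : ℤˣ) ≠ -1 := by decide

/-- A sum over `ℤˣ = {1, −1}`. [folklore] -/
private theorem sum_units (F : ℤˣ → ℝ) : ∑ e, F e = F 1 + F (-1) := by
  rw [UnitsInt.univ, Finset.sum_pair one_ne_neg_one_U]

/-- `(1 − e)/2 ∈ {0, 1}`: the exponent `(1 − ε_κ)/2` of (5.19)/(5.25). [cite: Balaban1987RG1, (5.19) p.294] -/
def half (e : ℤˣ) : ℤ := if e = 1 then 0 else 1

/-- `(1 − 1)/2 = 0`. [cite: Balaban1987RG1, (5.19) p.294] -/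
@[simp] theorem half_one : half 1 = 0 := by simp [half]

/-- `(1 − (−1))/2 = 1`. [cite: Balaban1987RG1, (5.19) p.294] -/
@[simp] theorem half_neg_one : half (-1) = 1 := by simp [half]

/-- `εx = (ε_κ x_κ)_κ`: the action of a sign vector on a lattice point (so that `(z^ε)^{−εx} = z^{−x}`).
[cite: Balaban1987RG1, (5.19) p.294] -/
def flipPt (ε : Fin d → ℤˣ) (x : Pt d) : Pt d := fun κ => (ε κ : ℤ) * x κ

/-- `flipPt` evaluated. [cite: Balaban1987RG1, (5.19) p.294] -/
@[simp] theorem flipPt_apply (ε : Fin d → ℤˣ) (x : Pt d) (κ : Fin d) : flipPt ε x κ = (ε κ : ℤ) * x κ := rfl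

/-- `ε(εx) = x`. [cite: Balaban1987RG1, (5.19) p.294] -/
@[simp] theorem flipPt_flipPt (ε : Fin d → ℤˣ) (x : Pt d) : flipPt ε (flipPt ε x) = x := by
  funext κ
  simp only [flipPt_apply, ← mul_assoc, ← Units.val_mul, Int.units_mul_self, Units.val_one, one_mul]

/-- `(εε′)x = ε(ε′x)`. [cite: Balaban1987RG1, (5.19) p.294] -/
theorem flipPt_mul (ε ε' : Fin d → ℤˣ) (x : Pt d) : flipPt (ε * ε') x = flipPt ε (flipPt ε' x) := by
  funext κ; simp [mul_assoc]

/-- `ε(x + y) = εx + εy`. [cite: Balaban1987RG1, (5.19) p.294] -/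
theorem flipPt_add (ε : Fin d → ℤˣ) (x y : Pt d) : flipPt ε (x + y) = flipPt ε x + flipPt ε y := by
  funext κ; simp [mul_add]

/-- `(+1,…,+1)x = x`. [cite: Balaban1987RG1, (5.19) p.294] -/
@[simp] theorem flipPt_one (x : Pt d) : flipPt (1 : Fin d → ℤˣ) x = x := by
  funext κ; simp

/-- `(−1,…,−1)x = −x`. [cite: Balaban1987RG1, (5.20) p.294] -/
@[simp] theorem flipPt_neg_one (x : Pt d) : flipPt (-1 : Fin d → ℤˣ) x = -x := by
  funext κ; simp

/-! ## §1. (5.29)/(5.17): `f_{μν}(z) = Σ_x z^{−x} Π_{μν}(x)` -/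

/-- **(5.29)** (with (5.17) `z_μ = e^{iζ_μ}` and (5.11) `Π̃(ζ) = Σ_x e^{−iζ·x}Π(x)`): the function
`f_{μν}(z) = Σ_{x∈ℤ^d} z^{−x} Π_{μν}(x)` of the complex variables `z`, for a family `c = (Π_{μν})` of lattice kernels.
[cite: Balaban1987RG1, (5.29) p.295] -/
def f529 (c : Fin d → Fin d → Pt d → ℂ) (μ ν : Fin d) (z : Fin d → ℂ) : ℂ := ∑' x, c μ ν x * zpowv z (-x)

/-- `z^{−x} = (z⁻¹)^{x}` (with `0⁻¹ = 0`, at every point). [folklore] -/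
private theorem zpowv_neg_eq_inv (z : Fin d → ℂ) (x : Pt d) : zpowv z (-x) = zpowv (fun κ => (z κ)⁻¹) x := by
  unfold zpowv
  exact Finset.prod_congr rfl fun κ _ => by simp [zpow_neg]

/-- (5.29) is the Laurent series `genFun` of [43] at `z⁻¹`: `f_{μν}(z) = Σ_x Π_{μν}(x)(z⁻¹)^x`.
[cite: Balaban1987RG1, (5.29) p.295] -/
theorem f529_eq_genFun (c : Fin d → Fin d → Pt d → ℂ) (μ ν : Fin d) (z : Fin d → ℂ) :
    f529 c μ ν z = genFun (c μ ν) (fun κ => (z κ)⁻¹) := by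
  unfold f529 genFun
  exact tsum_congr fun x => by rw [zpowv_neg_eq_inv]

/-- The poly-annulus `e^{−b} ≤ |z_j| ≤ e^{b}` is stable under `z ↦ z⁻¹`. [folklore] -/
private theorem inv_mem_polyAnnulus {b : ℝ} {z : Fin d → ℂ} (hz : z ∈ PolyAnnulus d b) :
    (fun κ => (z κ)⁻¹) ∈ PolyAnnulus d b := by
  intro j
  obtain ⟨h1, h2⟩ := hz j
  have hpos : 0 < ‖z j‖ := (Real.exp_pos _).trans_le h1
  rw [norm_inv]
  refine ⟨?_, ?_⟩
  · rw [Real.exp_neg]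
    exact inv_anti₀ hpos h2
  · calc ‖z j‖⁻¹ ≤ (Real.exp (-b))⁻¹ := inv_anti₀ (Real.exp_pos _) h1
      _ = Real.exp b := by rw [Real.exp_neg, inv_inv]

/-- Absolute convergence of (5.29) on the closed poly-annulus of width `b < a` for `a`-decaying coefficients — the
printed «The functions f_{μν}(z) are analytic on the polyring ×_μ{e^{−δ₁} < |z_μ| < e^{δ₁}}» on the coefficient side
((5.10) = `ExpBound δ₁`). [cite: Balaban1987RG1, (5.17) p.294] -/
theorem summable_norm_f529 {a M b : ℝ} {c : Fin d → Fin d → Pt d → ℂ} {μ ν : Fin d}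
    (hc : ExpBound a M (c μ ν)) (hab : b < a) {z : Fin d → ℂ} (hz : z ∈ PolyAnnulus d b) :
    Summable fun x => ‖c μ ν x * zpowv z (-x)‖ := by
  have h := fun x => hc.norm_mul_zpowv_le (inv_mem_polyAnnulus hz) x
  simp_rw [zpowv_neg_eq_inv]
  exact Summable.of_nonneg_of_le (fun _ => norm_nonneg _) h ((summable_wt (by linarith) d).mul_left M)

/-! ## §2. The one-coordinate weights of the printed splitting (p. 294) -/

/-- The role of a coordinate `κ` for the pair `(μ, ν)`: p. 294 distinguishes «the index … different from μ, ν»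
(or any index, if `μ = ν`), «the index … equal to μ» and «equal to ν». [cite: Balaban1987RG1, (5.22) p.294] -/
inductive Role
  | gen
  | mu
  | nu
  deriving DecidableEq

/-- The role of the coordinate `κ` for the pair `(μ, ν)` ((5.23): generic = «λ different from μ, ν, if μ ≠ ν, or …
all the indices λ, if μ = ν»). [cite: Balaban1987RG1, (5.23) p.294] -/
def role (μ ν κ : Fin d) : Role :=
  if μ = ν then Role.gen else if κ = μ then Role.mu else if κ = ν then Role.nu else Role.gen

/-- `role μ ν μ = mu` for `μ ≠ ν`. [cite: Balaban1987RG1, (5.24) p.294] -/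
theorem role_mu {μ ν : Fin d} (h : μ ≠ ν) : role μ ν μ = Role.mu := by simp [role, h]

/-- `role μ ν ν = nu` for `μ ≠ ν`. [cite: Balaban1987RG1, (5.24) p.294] -/
theorem role_nu {μ ν : Fin d} (h : μ ≠ ν) : role μ ν ν = Role.nu := by
  simp [role, h, Ne.symm h]

/-- The ONE-COORDINATE WEIGHT with which the term `z^{−n}` of (5.29) enters the `e`-piece (`e = +1`: the part `g⁺`
analytic in `z`, i.e. `n ≤ 0`; `e = −1`: the part `g⁻` analytic in `z⁻¹`, i.e. `n ≥ 0`), boundary terms `n = 0`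
distributed by the printed normalisations: generic coordinate — halved (`g⁺(0) = g⁻(0)`); coordinate μ — to `g⁻`
(`g⁺(0) = 0`); coordinate ν — to `g⁺` (`g⁻(0) = 0`). [cite: Balaban1987RG1, (5.22) p.294] -/
def w1 : Role → ℤˣ → ℤ → ℝ
  | Role.gen, e, n => if n = 0 then 1 / 2 else if (e : ℤ) * n < 0 then 1 else 0
  | Role.mu, e, n => if e = 1 then (if n < 0 then 1 else 0) else (if 0 ≤ n then 1 else 0)
  | Role.nu, e, n => if e = 1 then (if n ≤ 0 then 1 else 0) else (if 0 < n then 1 else 0)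

/-- `0 ≤ w1 ≤ 1`, lower half. [cite: Balaban1987RG1, (5.22) p.294] -/
theorem w1_nonneg (r : Role) (e : ℤˣ) (n : ℤ) : 0 ≤ w1 r e n := by
  cases r <;> simp only [w1] <;> split_ifs <;> norm_num

/-- `0 ≤ w1 ≤ 1`, upper half. [cite: Balaban1987RG1, (5.22) p.294] -/
theorem w1_le_one (r : Role) (e : ℤˣ) (n : ℤ) : w1 r e n ≤ 1 := by
  cases r <;> simp only [w1] <;> split_ifs <;> norm_num

/-- Each term of (5.29) is distributed completely between `g⁺` and `g⁻`: `w1 r (+1) n + w1 r (−1) n = 1`.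
[cite: Balaban1987RG1, (5.22) p.294] -/
theorem sum_w1 (r : Role) (n : ℤ) : ∑ e, w1 r e n = 1 := by
  rw [sum_units]
  cases r <;> simp only [w1, Units.val_one, Units.val_neg, one_mul, neg_mul, neg_one_ne_one_U, if_true,
    if_false] <;> split_ifs <;> (try norm_num) <;> omega

/-- On the support of the weight the exponent of the piece is non-negative: `w1 r e n ≠ 0 ⇒ e·n ≤ 0`.
[cite: Balaban1987RG1, (5.22) p.294] -/
theorem mul_nonpos_of_w1_ne_zero {r : Role} {e : ℤˣ} {n : ℤ} (h : w1 r e n ≠ 0) : (e : ℤ) * n ≤ 0 := by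
  rcases Int.units_eq_one_or e with rfl | rfl <;> cases r <;>
    simp only [w1, Units.val_one, Units.val_neg, one_mul, neg_mul, neg_one_ne_one_U, if_true, if_false] at h ⊢ <;>
    split_ifs at h <;> first | omega | exact absurd rfl h

/-- The weight of the lattice point `x` in the piece `g^ε_{μν}`: the product of the one-coordinate weights.
[cite: Balaban1987RG1, (5.22) p.294] -/
def wgt (μ ν : Fin d) (ε : Fin d → ℤˣ) (x : Pt d) : ℝ := ∏ κ, w1 (role μ ν κ) (ε κ) (x κ)

/-- `0 ≤ wgt`. [cite: Balaban1987RG1, (5.22) p.294] -/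
theorem wgt_nonneg (μ ν : Fin d) (ε : Fin d → ℤˣ) (x : Pt d) : 0 ≤ wgt μ ν ε x :=
  Finset.prod_nonneg fun _ _ => w1_nonneg _ _ _

/-- `wgt ≤ 1`. [cite: Balaban1987RG1, (5.22) p.294] -/
theorem wgt_le_one (μ ν : Fin d) (ε : Fin d → ℤˣ) (x : Pt d) : wgt μ ν ε x ≤ 1 :=
  Finset.prod_le_one (fun _ _ => w1_nonneg _ _ _) fun _ _ => w1_le_one _ _ _

/-- `‖(wgt : ℂ)‖ ≤ 1`. [cite: Balaban1987RG1, (5.22) p.294] -/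
theorem norm_wgt_le_one (μ ν : Fin d) (ε : Fin d → ℤˣ) (x : Pt d) : ‖(wgt μ ν ε x : ℂ)‖ ≤ 1 := by
  rw [Complex.norm_real, Real.norm_eq_abs, abs_of_nonneg (wgt_nonneg μ ν ε x)]
  exact wgt_le_one μ ν ε x

/-- **Every term of (5.29) is distributed completely among the `2^d` pieces**: `Σ_ε wgt μ ν ε x = 1`.
[cite: Balaban1987RG1, (5.22) p.294] -/
theorem sum_wgt (μ ν : Fin d) (x : Pt d) : ∑ ε : Fin d → ℤˣ, wgt μ ν ε x = 1 := by
  have h := Finset.prod_univ_sum (fun _ : Fin d => (Finset.univ : Finset ℤˣ))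
    (fun κ e => w1 (role μ ν κ) e (x κ))
  rw [Fintype.piFinset_univ] at h
  unfold wgt
  rw [← h]
  exact Finset.prod_eq_one fun κ _ => sum_w1 _ _

/-- On the support of `wgt μ ν ε x` every exponent `−ε_κ x_κ` of the monomial `w^{−εx}` is `≥ 0` (the pieces are POWER
series). [cite: Balaban1987RG1, (5.22) p.294] -/
theorem exponent_nonneg_of_wgt_ne_zero {μ ν : Fin d} {ε : Fin d → ℤˣ} {x : Pt d} (h : wgt μ ν ε x ≠ 0)
    (κ : Fin d) : 0 ≤ (-flipPt ε x) κ := by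
  have hκ := Finset.prod_ne_zero_iff.mp h κ (Finset.mem_univ κ)
  have := mul_nonpos_of_w1_ne_zero hκ
  simp only [Pi.neg_apply, flipPt_apply]
  omega

/-! ## §3. The pieces `g^ε` as restricted sums; (5.22) -/

/-- **The piece `g^ε_{μν}`** of (5.22) as a function of its own variables `w` (a power series): the sum (5.29)
restricted to the `ε`-orthant with the printed boundary normalisations, `g^ε_{μν}(w) = Σ_x wgt(ε,x) Π_{μν}(x) w^{−εx}`
(so that `g^ε(z^ε)` is the restricted sum `Σ_x wgt(ε,x) Π(x) z^{−x}`, `eq529_restricted`).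
[cite: Balaban1987RG1, (5.22) p.294] -/
def piece (c : Fin d → Fin d → Pt d → ℂ) (μ ν : Fin d) (ε : Fin d → ℤˣ) (w : Fin d → ℂ) : ℂ :=
  ∑' x, (wgt μ ν ε x : ℂ) * (c μ ν x * zpowv w (-flipPt ε x))

/-- **`g_{μν} = g^{(+1,…,+1)}_{μν}`** («Denoting g_{μν}(z) = g^{(+1,…,+1)}_{μν}(z)»). [cite: Balaban1987RG1, (5.26) p.295] -/
def gRep (c : Fin d → Fin d → Pt d → ℂ) (μ ν : Fin d) (w : Fin d → ℂ) : ℂ := piece c μ ν 1 w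

/-- `(z^ε)^{−εx} = z^{−x}` (`ε_κ² = 1`; valid at every point). [cite: Balaban1987RG1, (5.22) p.294] -/
theorem zpowv_twist_neg_flip (ε : Fin d → ℤˣ) (z : Fin d → ℂ) (x : Pt d) :
    zpowv (twist ε z) (-flipPt ε x) = zpowv z (-x) := by
  unfold zpowv twist
  refine Finset.prod_congr rfl fun κ _ => ?_
  simp only [Pi.neg_apply, flipPt_apply]
  rw [← zpow_mul]
  congr 1
  rcases Int.units_eq_one_or (ε κ) with h | h <;> simp [h]

/-- **«the terms of the representation (5.22) are obtained by restricting correspondingly the range of the summation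
in (5.29)»**: `g^ε_{μν}(z^ε) = Σ_x wgt(ε,x) Π_{μν}(x) z^{−x}` (at every point `z`). [cite: Balaban1987RG1, (5.29) p.295] -/
theorem eq529_restricted (c : Fin d → Fin d → Pt d → ℂ) (μ ν : Fin d) (ε : Fin d → ℤˣ) (z : Fin d → ℂ) :
    piece c μ ν ε (twist ε z) = ∑' x, (wgt μ ν ε x : ℂ) * (c μ ν x * zpowv z (-x)) := by
  unfold piece
  exact tsum_congr fun x => by rw [zpowv_twist_neg_flip]

/-- **(5.22)** `f_{μν}(z) = Σ_ε g^ε_{μν}(z^ε)`, PROVED at every point where the series (5.29) converges absolutely (in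
particular on the whole open polyring, `eq522_polyAnnulus`). [cite: Balaban1987RG1, (5.22) p.294] -/
theorem eq522 (c : Fin d → Fin d → Pt d → ℂ) (μ ν : Fin d) {z : Fin d → ℂ}
    (hs : Summable fun x => ‖c μ ν x * zpowv z (-x)‖) :
    f529 c μ ν z = ∑ ε : Fin d → ℤˣ, piece c μ ν ε (twist ε z) := by
  have hsum : ∀ ε : Fin d → ℤˣ, Summable fun x => (wgt μ ν ε x : ℂ) * (c μ ν x * zpowv z (-x)) :=
    fun ε => Summable.of_norm_bounded hs fun x => by
      rw [norm_mul]
      exact mul_le_of_le_one_left (norm_nonneg _) (norm_wgt_le_one μ ν ε x)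
  simp_rw [eq529_restricted]
  rw [← Summable.tsum_finsetSum (fun ε _ => hsum ε)]
  unfold f529
  refine tsum_congr fun x => ?_
  rw [← Finset.sum_mul, ← Complex.ofReal_sum, sum_wgt, Complex.ofReal_one, one_mul]

/-- (5.22) on the closed poly-annulus `e^{−b} ≤ |z_j| ≤ e^{b}`, `b < a`, for `a`-decaying kernels ((5.10)).
[cite: Balaban1987RG1, (5.22) p.294] -/
theorem eq522_polyAnnulus {a M b : ℝ} {c : Fin d → Fin d → Pt d → ℂ} {μ ν : Fin d}
    (hc : ExpBound a M (c μ ν)) (hab : b < a) {z : Fin d → ℂ} (hz : z ∈ PolyAnnulus d b) :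
    f529 c μ ν z = ∑ ε : Fin d → ℤˣ, piece c μ ν ε (twist ε z) :=
  eq522 c μ ν (summable_norm_f529 hc hab hz)

/-- The closed polydisc `|w_j| ≤ e^{b}` («the polydisc ×_μ{|z_μ| < e^{δ₁}}» is the union of these over `b < δ₁`).
[cite: Balaban1987RG1, (5.22) p.294] -/
def PolyDisc (d : ℕ) (b : ℝ) : Set (Fin d → ℂ) := {w | ∀ j, ‖w j‖ ≤ Real.exp b}

/-- The summands of a piece are bounded by `M e^{−(a−b)|x|₁}` on the closed polydisc of radius `e^b` (exponents are
non-negative on the support of the weight). [cite: Balaban1987RG1, (5.22) p.294] -/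
theorem norm_summand_piece_le {a M : ℝ} {c : Fin d → Fin d → Pt d → ℂ} {μ ν : Fin d}
    (hc : ExpBound a M (c μ ν)) (ε : Fin d → ℤˣ) {b : ℝ} {w : Fin d → ℂ} (hw : w ∈ PolyDisc d b) (x : Pt d) :
    ‖(wgt μ ν ε x : ℂ) * (c μ ν x * zpowv w (-flipPt ε x))‖ ≤ M * wt (a - b) x := by
  by_cases h0 : wgt μ ν ε x = 0
  · rw [h0, Complex.ofReal_zero, zero_mul, norm_zero]
    exact mul_nonneg hc.nonneg (wt_pos _ _).le
  · have hexp : ∀ κ, 0 ≤ (-flipPt ε x) κ := exponent_nonneg_of_wgt_ne_zero h0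
    have hz : ‖zpowv w (-flipPt ε x)‖ ≤ Real.exp (b * l1 x) := by
      unfold zpowv l1
      rw [norm_prod, Finset.mul_sum, Real.exp_sum]
      refine Finset.prod_le_prod (fun _ _ => norm_nonneg _) fun κ _ => ?_
      obtain ⟨n, hn⟩ := Int.eq_ofNat_of_zero_le (hexp κ)
      have habs : |(x κ : ℝ)| = n := by
        have h1 : (-flipPt ε x) κ = n := hn
        simp only [Pi.neg_apply, flipPt_apply] at h1
        rcases Int.units_eq_one_or (ε κ) with h | h
        · rw [h, Units.val_one, one_mul] at h1
          have : (x κ : ℝ) = -(n : ℝ) := by exact_mod_cast (by omega : x κ = -(n : ℤ))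
          rw [this, abs_neg, Nat.abs_cast]
        · rw [h, Units.val_neg, Units.val_one, neg_mul, one_mul, neg_neg] at h1
          have : (x κ : ℝ) = (n : ℝ) := by exact_mod_cast h1
          rw [this, Nat.abs_cast]
      rw [hn, zpow_natCast, norm_pow, habs, mul_comm b, Real.exp_nat_mul]
      exact pow_le_pow_left₀ (norm_nonneg _) (hw κ) n
    calc ‖(wgt μ ν ε x : ℂ) * (c μ ν x * zpowv w (-flipPt ε x))‖
        = ‖(wgt μ ν ε x : ℂ)‖ * (‖c μ ν x‖ * ‖zpowv w (-flipPt ε x)‖) := by rw [norm_mul, norm_mul]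
      _ ≤ 1 * ((M * wt a x) * Real.exp (b * l1 x)) :=
        mul_le_mul (norm_wgt_le_one μ ν ε x) (mul_le_mul (hc x) hz (norm_nonneg _)
          (mul_nonneg hc.nonneg (wt_pos _ _).le)) (by positivity) zero_le_one
      _ = M * wt (a - b) x := by
        rw [one_mul, wt, wt, mul_assoc, ← Real.exp_add]
        congr 2
        ring

/-- **«the functions g^ε_{μν}(z) are analytic on the polydisc ×_μ{|z_μ| < e^{δ₁}}»**, coefficient side: the power
series of every piece converges absolutely on every closed polydisc `|w_j| ≤ e^{b}`, `b < a`, for an `a`-decaying kernel.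
[cite: Balaban1987RG1, (5.22) p.294] -/
theorem summable_norm_piece {a M : ℝ} {c : Fin d → Fin d → Pt d → ℂ} {μ ν : Fin d}
    (hc : ExpBound a M (c μ ν)) (ε : Fin d → ℤˣ) {b : ℝ} (hab : b < a) {w : Fin d → ℂ} (hw : w ∈ PolyDisc d b) :
    Summable fun x => ‖(wgt μ ν ε x : ℂ) * (c μ ν x * zpowv w (-flipPt ε x))‖ :=
  Summable.of_nonneg_of_le (fun _ => norm_nonneg _) (norm_summand_piece_le hc ε hw)
    ((summable_wt (by linarith) d).mul_left M)

/-- The sup bound `|g^ε_{μν}(w)| ≤ M·Z_d(a − b)` on the closed polydisc of radius `e^b`, `b < a`.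
[cite: Balaban1987RG1, (5.22) p.294] -/
theorem norm_piece_le {a M : ℝ} {c : Fin d → Fin d → Pt d → ℂ} {μ ν : Fin d}
    (hc : ExpBound a M (c μ ν)) (ε : Fin d → ℤˣ) {b : ℝ} (hab : b < a) {w : Fin d → ℂ} (hw : w ∈ PolyDisc d b) :
    ‖piece c μ ν ε w‖ ≤ M * Zd (a - b) d := by
  have hs : Summable fun x : Pt d => M * wt (a - b) x := (summable_wt (by linarith) d).mul_left M
  have hn := summable_norm_piece hc ε hab hw
  calc ‖piece c μ ν ε w‖ ≤ ∑' x, ‖(wgt μ ν ε x : ℂ) * (c μ ν x * zpowv w (-flipPt ε x))‖ :=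
        norm_tsum_le_tsum_norm hn
    _ ≤ ∑' x, M * wt (a - b) x := hn.tsum_le_tsum (norm_summand_piece_le hc ε hw) hs
    _ = M * Zd (a - b) d := by rw [tsum_mul_left, Zd]

/-! ## §4. The normalisations (5.23), (5.24) -/

/-- A monomial with a non-zero exponent in the coordinate `l` vanishes at `w_l = 0`. [folklore] -/
private theorem zpowv_update_zero_of_ne (w : Fin d → ℂ) {l : Fin d} {m : Pt d} (hm : m l ≠ 0) :
    zpowv (Function.update w l 0) m = 0 := by
  unfold zpowv
  exact Finset.prod_eq_zero (Finset.mem_univ l) (by rw [Function.update_self]; exact zero_zpow _ hm)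

/-- **(5.23)** for the pieces of §3: in a generic coordinate `λ` (λ ∉ {μ, ν} if μ ≠ ν; any λ if μ = ν) the `ε_λ = +1` and
the `ε_λ = −1` pieces agree at `z_λ = 0` (both reduce to the `x_λ = 0` layer, carried with weight ½ by each —
«g⁺(0) = g⁻(0)»). [cite: Balaban1987RG1, (5.23) p.294] -/
theorem eq523 (c : Fin d → Fin d → Pt d → ℂ) {μ ν l : Fin d} (hl : role μ ν l = Role.gen)
    (ε : Fin d → ℤˣ) (w : Fin d → ℂ) :
    piece c μ ν (Function.update ε l 1) (Function.update w l 0)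
      = piece c μ ν (Function.update ε l (-1)) (Function.update w l 0) := by
  unfold piece
  refine tsum_congr fun x => ?_
  by_cases hx : x l = 0
  · have hflip : flipPt (Function.update ε l 1) x = flipPt (Function.update ε l (-1)) x := by
      funext κ
      by_cases h : κ = l
      · subst h; simp [hx]
      · simp [Function.update_of_ne h]
    have hw : wgt μ ν (Function.update ε l 1) x = wgt μ ν (Function.update ε l (-1)) x := by
      unfold wgt
      refine Finset.prod_congr rfl fun κ _ => ?_
      by_cases h : κ = l
      · subst h
        rw [Function.update_self, Function.update_self, hl, hx]
        simp [w1]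
      · rw [Function.update_of_ne h, Function.update_of_ne h]
    rw [hflip, hw]
  · have h1 : zpowv (Function.update w l 0) (-flipPt (Function.update ε l 1) x) = 0 :=
      zpowv_update_zero_of_ne w (by simpa using hx)
    have h2 : zpowv (Function.update w l 0) (-flipPt (Function.update ε l (-1)) x) = 0 :=
      zpowv_update_zero_of_ne w (by simpa using hx)
    rw [h1, h2, mul_zero, mul_zero, mul_zero]

/-- **(5.24), first member** (the prose's «g⁺(0) = 0» for the index μ): for `μ ≠ ν` every piece with `ε_μ = +1` vanishes
at `z_μ = 0`. [cite: Balaban1987RG1, (5.24) p.294] -/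
theorem eq524_mu (c : Fin d → Fin d → Pt d → ℂ) {μ ν : Fin d} (hμν : μ ≠ ν) {ε : Fin d → ℤˣ} (hε : ε μ = 1)
    (w : Fin d → ℂ) : piece c μ ν ε (Function.update w μ 0) = 0 := by
  unfold piece
  refine (tsum_congr fun x => ?_).trans tsum_zero
  by_cases hx : x μ < 0
  · rw [zpowv_update_zero_of_ne w (m := -flipPt ε x) (by simp [hε]; omega), mul_zero, mul_zero]
  · have : wgt μ ν ε x = 0 :=
      Finset.prod_eq_zero (Finset.mem_univ μ) (by rw [role_mu hμν, hε]; simp [w1, hx])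
    rw [this, Complex.ofReal_zero, zero_mul]

/-- **The ν-normalisation** (the prose's «g⁻(0) = 0» for the index ν): for `μ ≠ ν` every piece with `ε_ν = −1`
vanishes at `z_ν = 0`. [cite: Balaban1987RG1, (5.24) p.294] -/
theorem eq524_nu (c : Fin d → Fin d → Pt d → ℂ) {μ ν : Fin d} (hμν : μ ≠ ν) {ε : Fin d → ℤˣ} (hε : ε ν = -1)
    (w : Fin d → ℂ) : piece c μ ν ε (Function.update w ν 0) = 0 := by
  unfold piece
  refine (tsum_congr fun x => ?_).trans tsum_zero
  by_cases hx : 0 < x ν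
  · rw [zpowv_update_zero_of_ne w (m := -flipPt ε x) (by simp [hε]; omega), mul_zero, mul_zero]
  · have : wgt μ ν ε x = 0 :=
      Finset.prod_eq_zero (Finset.mem_univ ν) (by rw [role_nu hμν, hε]; simp [w1, hx])
    rw [this, Complex.ofReal_zero, zero_mul]

/-- The value of a piece at the origin of the polydisc is the (weighted) `x = 0` term of (5.29):
`g^ε_{μν}(0) = wgt(ε,0)·Π_{μν}(0)`. [cite: Balaban1987RG1, (5.24) p.294] -/
theorem piece_zero (c : Fin d → Fin d → Pt d → ℂ) (μ ν : Fin d) (ε : Fin d → ℤˣ) :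
    piece c μ ν ε 0 = (wgt μ ν ε 0 : ℂ) * c μ ν 0 := by
  unfold piece
  rw [tsum_eq_single 0]
  · simp [zpowv]
  · intro x hx
    obtain ⟨κ, hκ⟩ : ∃ κ, x κ ≠ 0 := by
      by_contra h
      push Not at h
      exact hx (funext h)
    have : zpowv (0 : Fin d → ℂ) (-flipPt ε x) = 0 :=
      Finset.prod_eq_zero (Finset.mem_univ κ)
        (zero_zpow _ (by simpa using mul_ne_zero (Units.ne_zero (ε κ)) hκ))
    rw [this, mul_zero, mul_zero]

/-- For `μ ≠ ν` the weight of the origin in a piece with `ε_μ = −1`, `ε_ν = +1` is non-zero (`= 2^{−#generic}`): the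
`x = 0` term of (5.29) belongs to such pieces. [cite: Balaban1987RG1, (5.24) p.294] -/
theorem wgt_zero_ne_zero {μ ν : Fin d} (hμν : μ ≠ ν) {ε : Fin d → ℤˣ} (hμ : ε μ = -1) (hν : ε ν = 1) :
    wgt μ ν ε 0 ≠ 0 := by
  unfold wgt
  refine Finset.prod_ne_zero_iff.mpr fun κ _ => ?_
  simp only [Pi.zero_apply]
  unfold role
  split_ifs with h1 h2 h3
  · exact absurd h1 hμν
  · subst h2; rw [hμ]; simp [w1]
  · subst h3; rw [hν]; simp [w1]
  · simp [w1]

/-- **LOCATED READING NOTE on (5.24)** (kernel witness): the second member of (5.24) AS RENDERED —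
«g^{(ε′,ε_μ=−1,ε″)}_{μν}(z′, 0, z″) = 0» — FAILS for the printed construction whenever `Π_{μν}(0) ≠ 0` (`μ ≠ ν`,
`d ≥ 2`): at `z′ = z″ = 0` such a piece (with `ε_ν = +1`) takes the value `wgt(ε,0)·Π_{μν}(0) ≠ 0`.  (The condition
that holds is the ν-one, `eq524_nu`; cf. (5.25): for `ε_μ = −1`, `g^ε = −z_μ⁻¹⋯g` equals `−∂g/∂z_μ` at `z_μ = 0`.)
[cite: Balaban1987RG1, (5.24) p.294] -/
theorem not_eq524_second_member (c : Fin d → Fin d → Pt d → ℂ) {μ ν : Fin d} (hμν : μ ≠ ν)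
    {ε : Fin d → ℤˣ} (hμ : ε μ = -1) (hν : ε ν = 1) (h0 : c μ ν 0 ≠ 0) :
    piece c μ ν ε (Function.update 0 μ 0) ≠ 0 := by
  rw [show Function.update (0 : Fin d → ℂ) μ 0 = 0 from Function.update_eq_self μ 0, piece_zero]
  exact mul_ne_zero (by exact_mod_cast wgt_zero_ne_zero hμν hμ hν) h0

/-! ## §5. (5.25) and the representation (5.26), from the coefficient form of (5.19) = (5.13) -/

/-- The half-bond shift of (5.19)/(5.13) for the sign vector `ε`: `s(ε) = −((1−ε_μ)/2)e_μ + ((1−ε_ν)/2)e_ν`.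
[cite: Balaban1987RG1, (5.19) p.294] -/
def shiftPt (μ ν : Fin d) (ε : Fin d → ℤˣ) : Pt d :=
  fun κ => (if κ = μ then -half (ε μ) else 0) + (if κ = ν then half (ε ν) else 0)

/-- **(5.19) on the coefficient side** (= (5.13)/(5.7) for the sign vector `ε`): `Π_{μν}(εy) = ε_με_ν Π_{μν}(y + s(ε))`.
Substituting in (5.29) gives exactly the printed `f_{μν}(z^ε) = ε_με_ν z_μ^{−(1−ε_μ)/2} z_ν^{(1−ε_ν)/2} f_{μν}(z)`.
[cite: Balaban1987RG1, (5.19) p.294] -/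
def Cov519 (c : Fin d → Fin d → Pt d → ℂ) (μ ν : Fin d) (ε : Fin d → ℤˣ) : Prop :=
  ∀ y : Pt d, c μ ν (flipPt ε y) = sgn (ε μ) * sgn (ε ν) * c μ ν (y + shiftPt μ ν ε)

/-- The shift seen by a coordinate, by role: `0` (generic), `−(1−e)/2` (coordinate μ), `+(1−e)/2` (coordinate ν).
[cite: Balaban1987RG1, (5.19) p.294] -/
def rshift : Role → ℤˣ → ℤ
  | Role.gen, _ => 0
  | Role.mu, e => -half e
  | Role.nu, e => half e

/-- The shift of (5.19) coordinate-wise. [cite: Balaban1987RG1, (5.19) p.294] -/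
theorem shiftPt_eq_rshift (μ ν : Fin d) (ε : Fin d → ℤˣ) (κ : Fin d) :
    shiftPt μ ν ε κ = rshift (role μ ν κ) (ε κ) := by
  unfold shiftPt role
  by_cases hμν : μ = ν
  · subst hμν
    by_cases h1 : κ = μ
    · subst h1; simp [rshift]
    · simp [h1, rshift]
  · by_cases h1 : κ = μ
    · subst h1; simp [hμν, rshift]
    · by_cases h2 : κ = ν
      · subst h2; simp [h1, hμν, rshift]
      · simp [hμν, h1, h2, rshift]

/-- The one-coordinate weights are carried to the `(+1)`-weights by the substitution of (5.25):
`w1 r e (e(u − s_r(e))) = w1 r (+1) u`. [cite: Balaban1987RG1, (5.25) p.295] -/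
theorem w1_reindex (r : Role) (e : ℤˣ) (u : ℤ) : w1 r e ((e : ℤ) * (u - rshift r e)) = w1 r 1 u := by
  rcases Int.units_eq_one_or e with rfl | rfl
  · cases r <;> simp [w1, rshift]
  · cases r <;> simp only [w1, rshift, half_neg_one, Units.val_neg, Units.val_one, neg_mul, one_mul,
      neg_one_ne_one_U, if_true, if_false, sub_zero, neg_neg] <;> split_ifs <;> first | rfl | omega

/-- The weights are carried to the `(+1,…,+1)`-weights by the substitution `x = ε(u − s(ε))` of (5.25).
[cite: Balaban1987RG1, (5.25) p.295] -/
theorem wgt_reindex525 (μ ν : Fin d) (ε : Fin d → ℤˣ) (u : Pt d) :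
    wgt μ ν ε (flipPt ε (u - shiftPt μ ν ε)) = wgt μ ν 1 u := by
  unfold wgt
  refine Finset.prod_congr rfl fun κ _ => ?_
  simp only [flipPt_apply, Pi.sub_apply, Pi.one_apply, shiftPt_eq_rshift]
  exact w1_reindex _ _ _

/-- The substitution `x = ε(u − s(ε))` as a bijection of `ℤ^d`. [cite: Balaban1987RG1, (5.25) p.295] -/
def reindex525 (μ ν : Fin d) (ε : Fin d → ℤˣ) : Pt d ≃ Pt d where
  toFun u := flipPt ε (u - shiftPt μ ν ε)
  invFun x := flipPt ε x + shiftPt μ ν ε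
  left_inv u := by simp
  right_inv x := by simp

/-- `z^{m+n} = z^m z^n` at points with non-zero coordinates. [folklore] -/
private theorem zpowv_add {w : Fin d → ℂ} (hw : ∀ κ, w κ ≠ 0) (m n : Pt d) :
    zpowv w (m + n) = zpowv w m * zpowv w n := by
  unfold zpowv
  rw [← Finset.prod_mul_distrib]
  exact Finset.prod_congr rfl fun κ _ => by rw [Pi.add_apply, zpow_add₀ (hw κ)]

/-- `z^{m−n} = z^m z^{−n}` at points with non-zero coordinates. [folklore] -/
private theorem zpowv_sub {w : Fin d → ℂ} (hw : ∀ κ, w κ ≠ 0) (m n : Pt d) :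
    zpowv w (m - n) = zpowv w m * zpowv w (-n) := by
  rw [sub_eq_add_neg, zpowv_add hw]

/-- A monomial supported on one coordinate: `z^{n e_κ} = z_κ^n`. [folklore] -/
private theorem zpowv_single (w : Fin d → ℂ) (κ₀ : Fin d) (n : ℤ) :
    zpowv w (fun κ => if κ = κ₀ then n else 0) = w κ₀ ^ n := by
  unfold zpowv
  rw [Finset.prod_eq_single κ₀]
  · simp
  · intro κ _ hκ
    simp [hκ]
  · intro h
    exact absurd (Finset.mem_univ _) h

/-- The prefactor of (5.25): `z^{s(ε)} = (z_μ^{(1−ε_μ)/2})⁻¹ · z_ν^{(1−ε_ν)/2}` in the `low` notation of `B12Rep526`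
(`low e t = t^{(1−e)/2}`), at points with non-zero coordinates. [cite: Balaban1987RG1, (5.25) p.295] -/
theorem zpowv_shiftPt {w : Fin d → ℂ} (hw : ∀ κ, w κ ≠ 0) (μ ν : Fin d) (ε : Fin d → ℤˣ) :
    zpowv w (shiftPt μ ν ε) = (low (ε μ) (w μ))⁻¹ * low (ε ν) (w ν) := by
  have hsplit : shiftPt μ ν ε = (fun κ => if κ = μ then -half (ε μ) else 0) + (fun κ => if κ = ν then half (ε ν) else 0) := by
    funext κ; rfl
  rw [hsplit, zpowv_add hw, zpowv_single, zpowv_single]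
  congr 1
  · rcases Int.units_eq_one_or (ε μ) with h | h <;> simp [h]
  · rcases Int.units_eq_one_or (ε ν) with h | h <;> simp [h]

/-- **(5.25)** for the pieces of §3, from the coefficient form of (5.19): at every point with non-zero coordinates,
`g^ε_{μν}(w) = ε_με_ν w_μ^{−(1−ε_μ)/2} w_ν^{(1−ε_ν)/2} g_{μν}(w)`.  (For `ε_μ = −1` the left member is analytic at
`w_μ = 0` too, with the value `−∂g/∂w_μ` there — the reason the second member of (5.24) as rendered cannot hold.)
[cite: Balaban1987RG1, (5.25) p.295] -/
theorem eq525 (c : Fin d → Fin d → Pt d → ℂ) {μ ν : Fin d} {ε : Fin d → ℤˣ} (h : Cov519 c μ ν ε)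
    {w : Fin d → ℂ} (hw : ∀ κ, w κ ≠ 0) :
    piece c μ ν ε w = sgn (ε μ) * sgn (ε ν) * (low (ε μ) (w μ))⁻¹ * low (ε ν) (w ν) * gRep c μ ν w := by
  have step1 : piece c μ ν ε w = ∑' u, (wgt μ ν ε (flipPt ε (u - shiftPt μ ν ε)) : ℂ) *
      (c μ ν (flipPt ε (u - shiftPt μ ν ε)) * zpowv w (-flipPt ε (flipPt ε (u - shiftPt μ ν ε)))) :=
    ((reindex525 μ ν ε).tsum_eq (fun x => (wgt μ ν ε x : ℂ) * (c μ ν x * zpowv w (-flipPt ε x)))).symm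
  calc piece c μ ν ε w = _ := step1
    _ = ∑' u, (sgn (ε μ) * sgn (ε ν) * zpowv w (shiftPt μ ν ε)) *
          ((wgt μ ν 1 u : ℂ) * (c μ ν u * zpowv w (-flipPt 1 u))) := by
        refine tsum_congr fun u => ?_
        rw [wgt_reindex525, flipPt_flipPt, h (u - shiftPt μ ν ε), sub_add_cancel, neg_sub, zpowv_sub hw,
          flipPt_one]
        ring
    _ = sgn (ε μ) * sgn (ε ν) * (low (ε μ) (w μ))⁻¹ * low (ε ν) (w ν) * gRep c μ ν w := by
        rw [tsum_mul_left, zpowv_shiftPt hw]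
        unfold gRep piece
        ring

/-- (5.25) in the notation of `B12Rep526`: the pieces ARE the `g^ε` of `B12Rep526.gEps` built from `g = gRep c`.
[cite: Balaban1987RG1, (5.25) p.295] -/
theorem piece_eq_gEps (c : Fin d → Fin d → Pt d → ℂ) {μ ν : Fin d} {ε : Fin d → ℤˣ} (h : Cov519 c μ ν ε)
    {w : Fin d → ℂ} (hw : ∀ κ, w κ ≠ 0) : piece c μ ν ε w = gEps (gRep c) ε μ ν w := by
  rw [eq525 c h hw]; rfl

/-- **(5.26) — the representation, for the `f` and `g` of the paper**: on the part of the polyring where (5.29) converges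
absolutely (the whole open polyring for an exponentially decaying kernel, `eq526_polyAnnulus`), `f_{μν}(z) =
Σ_ε ε_με_ν z_μ^{(1−ε_μ)/2} z_ν^{−(1−ε_ν)/2} g_{μν}(z^ε)` with `g_{μν} = gRep c μ ν` = the restricted sum — i.e.
`f529 c = B12Rep526.rep526 (gRep c)`, so that `B12Rep526.eq519_of_rep526` ((5.19)), `eq518_of_eq527`, `eq520_of_eq528`
apply to them. [cite: Balaban1987RG1, (5.26) p.295] -/
theorem eq526 (c : Fin d → Fin d → Pt d → ℂ) {μ ν : Fin d} (h : ∀ ε, Cov519 c μ ν ε) {z : Fin d → ℂ}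
    (hz : ∀ κ, z κ ≠ 0) (hs : Summable fun x => ‖c μ ν x * zpowv z (-x)‖) :
    f529 c μ ν z = rep526 (gRep c) μ ν z := by
  rw [eq522 c μ ν hs, ← B12Rep526.eq522 (gRep c) μ ν z]
  refine Finset.sum_congr rfl fun ε _ => ?_
  exact piece_eq_gEps c (h ε) fun κ => zpow_ne_zero _ (hz κ)

/-- (5.26) on the closed poly-annulus `e^{−b} ≤ |z_j| ≤ e^{b}`, `b < a`, for an `a`-decaying kernel with (5.19).
[cite: Balaban1987RG1, (5.26) p.295] -/
theorem eq526_polyAnnulus {a M b : ℝ} {c : Fin d → Fin d → Pt d → ℂ} {μ ν : Fin d}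
    (hc : ExpBound a M (c μ ν)) (h : ∀ ε, Cov519 c μ ν ε) (hab : b < a) {z : Fin d → ℂ}
    (hz : z ∈ PolyAnnulus d b) : f529 c μ ν z = rep526 (gRep c) μ ν z :=
  eq526 c h (ne_zero_of_mem hz) (summable_norm_f529 hc hab hz)

/-! ### (5.19) for every sign vector from the single-axis reflections (5.13) of the tree -/

/-- `Cov519` at `ε = (+1,…,+1)` (trivial). [cite: Balaban1987RG1, (5.19) p.294] -/
theorem cov519_one (c : Fin d → Fin d → Pt d → ℂ) (μ ν : Fin d) : Cov519 c μ ν 1 := by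
  intro y
  have : shiftPt μ ν (1 : Fin d → ℤˣ) = 0 := by funext κ; simp [shiftPt]
  simp [this]

/-- The shifts compose like a cocycle: `ε′s(ε) + s(ε′) = s(εε′)`. [cite: Balaban1987RG1, (5.19) p.294] -/
theorem shiftPt_mul (μ ν : Fin d) (ε ε' : Fin d → ℤˣ) :
    flipPt ε' (shiftPt μ ν ε) + shiftPt μ ν ε' = shiftPt μ ν (ε * ε') := by
  funext κ
  simp only [Pi.add_apply, flipPt_apply, shiftPt, Pi.mul_apply]
  by_cases h1 : κ = μ <;> by_cases h2 : κ = ν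
  · subst h1; subst h2; simp
  · subst h1
    simp only [if_true, h2, if_false, add_zero]
    rcases Int.units_eq_one_or (ε κ) with h | h <;> rcases Int.units_eq_one_or (ε' κ) with h' | h' <;>
      simp [h, h', half]
  · subst h2
    simp only [h1, if_false, if_true, zero_add]
    rcases Int.units_eq_one_or (ε κ) with h | h <;> rcases Int.units_eq_one_or (ε' κ) with h' | h' <;>
      simp [h, h', half]
  · simp [h1, h2]

/-- `Cov519` is multiplicative in the sign vector (the `ε` form a group generated by single flips).
[cite: Balaban1987RG1, (5.19) p.294] -/
theorem cov519_mul {c : Fin d → Fin d → Pt d → ℂ} {μ ν : Fin d} {ε ε' : Fin d → ℤˣ}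
    (h : Cov519 c μ ν ε) (h' : Cov519 c μ ν ε') : Cov519 c μ ν (ε * ε') := by
  intro y
  have key : flipPt ε' y + shiftPt μ ν ε = flipPt ε' (y + flipPt ε' (shiftPt μ ν ε)) := by
    rw [flipPt_add, flipPt_flipPt]
  rw [flipPt_mul, h, key, h', ← shiftPt_mul, ← add_assoc]
  simp only [Pi.mul_apply, sgn_mul]
  ring

/-- The single flip of the axis `ρ`. [cite: Balaban1987RG1, (5.13) p.293] -/
def flipU (ρ : Fin d) : Fin d → ℤˣ := fun κ => if κ = ρ then -1 else 1

/-- Every sign vector is the product of the single flips of the axes where it is `−1`.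
[cite: Balaban1987RG1, (5.19) p.294] -/
theorem prod_flipU_eq (ε : Fin d → ℤˣ) :
    ∏ κ ∈ Finset.univ.filter (fun κ => ε κ = -1), flipU κ = ε := by
  funext l
  rw [Finset.prod_apply]
  simp only [flipU]
  rw [Finset.prod_ite_eq]
  simp only [Finset.mem_filter, Finset.mem_univ, true_and]
  rcases Int.units_eq_one_or (ε l) with h | h
  · rw [h, if_neg one_ne_neg_one_U]
  · rw [h, if_pos rfl]

/-- The real kernel of the tree as a complex coefficient family. [cite: Balaban1987RG1, (1.21) p.264] -/
def castK (P : B12Beta.Kernel d) : Fin d → Fin d → Pt d → ℂ := fun μ ν x => (P μ ν x : ℂ)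

/-- `castK` evaluated. [cite: Balaban1987RG1, (1.21) p.264] -/
@[simp] theorem castK_apply (P : B12Beta.Kernel d) (μ ν : Fin d) (x : Pt d) : castK P μ ν x = (P μ ν x : ℂ) := rfl

/-- DICTIONARY: the tree's single-axis reflection covariance (5.7)/(5.13) (`B12Transverse536.ReflCovariant`, in the
difference variable) IS `Cov519` for the single flips. [cite: Balaban1987RG1, (5.13) p.293] -/
theorem cov519_flipU_of_reflCovariant {P : B12Beta.Kernel d} (hR : B12Transverse536.ReflCovariant P)
    (ρ μ ν : Fin d) : Cov519 (castK P) μ ν (flipU ρ) := by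
  intro y
  have key : B12Transverse536.reflTwist ρ μ ν (y + shiftPt μ ν (flipU ρ)) = flipPt (flipU ρ) y := by
    funext κ
    by_cases hκ : κ = ρ
    · subst hκ
      rw [B12Transverse536.reflTwist_self]
      simp only [Pi.add_apply, shiftPt, flipU, if_true, flipPt_apply, B12Transverse536.tw]
      by_cases h1 : κ = μ <;> by_cases h2 : κ = ν
      · subst h1; subst h2; simp
      · subst h1; simp [Ne.symm h2]
      · subst h2; simp [Ne.symm h1]
      · simp [Ne.symm h1, Ne.symm h2]
    · rw [B12Transverse536.reflTwist_of_ne hκ]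
      simp only [Pi.add_apply, shiftPt, flipU, flipPt_apply, if_neg hκ, Units.val_one, one_mul]
      by_cases h1 : κ = μ <;> by_cases h2 : κ = ν
      · subst h1; subst h2; simp
      · subst h1; simp [hκ, h2]
      · subst h2; simp [hκ, h1]
      · simp [h1, h2]
  have := hR ρ μ ν (y + shiftPt μ ν (flipU ρ))
  rw [key] at this
  simp only [castK_apply, this, Complex.ofReal_mul]
  congr 2
  · simp only [B12Transverse536.rsgn, flipU, sgn]
    split_ifs <;> simp
  · simp only [B12Transverse536.rsgn, flipU, sgn]
    split_ifs <;> simp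

/-- **(5.19) on the coefficient side for EVERY sign vector**, from the tree's (5.13) `B12Transverse536.ReflCovariant`.
[cite: Balaban1987RG1, (5.19) p.294] -/
theorem cov519_of_reflCovariant {P : B12Beta.Kernel d} (hR : B12Transverse536.ReflCovariant P) (μ ν : Fin d)
    (ε : Fin d → ℤˣ) : Cov519 (castK P) μ ν ε := by
  rw [← prod_flipU_eq ε]
  exact Finset.prod_induction _ (fun δ => Cov519 (castK P) μ ν δ) (fun a b ha hb => cov519_mul ha hb)
    (cov519_one _ μ ν) (fun κ _ => cov519_flipU_of_reflCovariant hR κ μ ν)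

/-- (5.26) for a real B12 kernel with the tree's hypotheses: decay (5.10) `ExpBound a M` of the component and the
reflection covariance (5.13), on every closed sub-poly-annulus of the polyring. [cite: Balaban1987RG1, (5.26) p.295] -/
theorem eq526_of_reflCovariant {P : B12Beta.Kernel d} (hR : B12Transverse536.ReflCovariant P) {a M b : ℝ}
    {μ ν : Fin d} (hc : ExpBound a M (castK P μ ν)) (hab : b < a) {z : Fin d → ℂ} (hz : z ∈ PolyAnnulus d b) :
    f529 (castK P) μ ν z = rep526 (gRep (castK P)) μ ν z :=
  eq526_polyAnnulus hc (cov519_of_reflCovariant hR μ ν) hab hz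

/-! ## §6. (5.27) from (5.12), and (5.18) -/

/-- **(5.12) on the coefficient side** (complex form of the tree's `B12Beta.PermCovariant` (1.21)/(5.6)/(5.12)):
`Π_{σμ,σν}(x∘σ⁻¹) = Π_{μν}(x)`. [cite: Balaban1987RG1, (5.12) p.293] -/
def Perm512 (c : Fin d → Fin d → Pt d → ℂ) : Prop :=
  ∀ (σ : Equiv.Perm (Fin d)) (μ ν : Fin d) (x : Pt d), c (σ μ) (σ ν) (x ∘ σ.symm) = c μ ν x

/-- DICTIONARY: `B12Beta.PermCovariant P ⇒ Perm512 (castK P)`. [cite: Balaban1987RG1, (5.12) p.293] -/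
theorem perm512_of_permCovariant {P : B12Beta.Kernel d} (hP : B12Beta.PermCovariant P) : Perm512 (castK P) :=
  fun σ μ ν x => by simp only [castK_apply, hP σ μ ν x]

/-- `(rz)^m = z^{m∘r}` for the action `(rz)_μ = z_{r⁻¹μ}` of `B12Rep526.permZ`. [cite: Balaban1987RG1, (5.18) p.294] -/
theorem zpowv_permZ (r : Equiv.Perm (Fin d)) (z : Fin d → ℂ) (m : Pt d) :
    zpowv (permZ r z) m = zpowv z (m ∘ r) := by
  unfold zpowv
  exact Fintype.prod_equiv r.symm _ _ fun κ => by simp [permZ]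

/-- Roles are permutation-covariant. [cite: Balaban1987RG1, (5.27) p.295] -/
theorem role_perm (r : Equiv.Perm (Fin d)) (μ ν l : Fin d) :
    role μ ν (r l) = role (r.symm μ) (r.symm ν) l := by
  unfold role
  simp only [r.symm.injective.eq_iff, Equiv.apply_eq_iff_eq_symm_apply]

/-- The weights are permutation-covariant: `wgt_{μν}(ε, y∘r⁻¹) = wgt_{r⁻¹μ,r⁻¹ν}(ε∘r, y)`.
[cite: Balaban1987RG1, (5.27) p.295] -/
theorem wgt_perm (r : Equiv.Perm (Fin d)) (μ ν : Fin d) (ε : Fin d → ℤˣ) (y : Pt d) :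
    wgt μ ν ε (y ∘ r.symm) = wgt (r.symm μ) (r.symm ν) (ε ∘ r) y := by
  unfold wgt
  exact Fintype.prod_equiv r.symm _ _ fun κ => by simp [role_perm]

/-- **(5.27)** for the `g` of the paper, from (5.12): `g_{μν}(rz) = ((r⊗r)g)_{μν}(z) = g_{r⁻¹μ,r⁻¹ν}(z)` for every
permutation `r` of the axes (the reading `(rz)_μ = z_{r⁻¹μ}` of `B12Rep526`), at every point.
[cite: Balaban1987RG1, (5.27) p.295] -/
theorem eq527 (c : Fin d → Fin d → Pt d → ℂ) (hP : Perm512 c) (r : Equiv.Perm (Fin d)) (μ ν : Fin d)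
    (z : Fin d → ℂ) : gRep c μ ν (permZ r z) = gRep c (r.symm μ) (r.symm ν) z := by
  have he : ∀ y : Pt d, (Equiv.arrowCongr r (Equiv.refl ℤ)) y = y ∘ r.symm := fun y => by
    funext κ; simp [Equiv.arrowCongr_apply]
  unfold gRep piece
  rw [← (Equiv.arrowCongr r (Equiv.refl ℤ)).tsum_eq]
  refine tsum_congr fun y => ?_
  rw [he, flipPt_one, flipPt_one, zpowv_permZ, wgt_perm]
  have hc : c μ ν (y ∘ r.symm) = c (r.symm μ) (r.symm ν) y := by
    have := hP r (r.symm μ) (r.symm ν) y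
    simpa using this
  have hm : (-(y ∘ ⇑r.symm)) ∘ ⇑r = -y := by funext κ; simp
  rw [hc, hm]
  rfl

/-- **(5.18)** for `f = (5.29)`, from (5.12): `f_{μν}(rz) = f_{r⁻¹μ,r⁻¹ν}(z)` at every point.
[cite: Balaban1987RG1, (5.18) p.294] -/
theorem eq518 (c : Fin d → Fin d → Pt d → ℂ) (hP : Perm512 c) (r : Equiv.Perm (Fin d)) (μ ν : Fin d)
    (z : Fin d → ℂ) : f529 c μ ν (permZ r z) = f529 c (r.symm μ) (r.symm ν) z := by
  have he : ∀ y : Pt d, (Equiv.arrowCongr r (Equiv.refl ℤ)) y = y ∘ r.symm := fun y => by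
    funext κ; simp [Equiv.arrowCongr_apply]
  unfold f529
  rw [← (Equiv.arrowCongr r (Equiv.refl ℤ)).tsum_eq]
  refine tsum_congr fun y => ?_
  rw [he, zpowv_permZ]
  have hc : c μ ν (y ∘ r.symm) = c (r.symm μ) (r.symm ν) y := by
    have := hP r (r.symm μ) (r.symm ν) y
    simpa using this
  have hm : (-(y ∘ ⇑r.symm)) ∘ ⇑r = -y := by funext κ; simp
  rw [hc, hm]

/-! ## §7. (5.28) from (5.14) + (5.13), and (5.20) -/

/-- **(5.14) on the coefficient side** ((5.8), second member: «Π_{μν}(x) = Π_{νμ}(−x)»; (5.14) «Π_{μν}(ζ) = Π_{νμ}(−ζ)»).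
[cite: Balaban1987RG1, (5.14) p.293] -/
def Sym514 (c : Fin d → Fin d → Pt d → ℂ) : Prop := ∀ (μ ν : Fin d) (x : Pt d), c μ ν x = c ν μ (-x)

/-- The weights of the pair `(ν, μ)` shifted by `e_μ − e_ν` are the weights of the pair `(μ, ν)` (coordinate μ: «n ≤ 0
for the ν-role» at `n + 1` is «n < 0 for the μ-role»; coordinate ν symmetrically). [cite: Balaban1987RG1, (5.28) p.295] -/
theorem wgt_swap_shift (μ ν : Fin d) (y : Pt d) :
    wgt ν μ 1 (y + (unitVec μ - unitVec ν)) = wgt μ ν 1 y := by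
  by_cases hμν : μ = ν
  · subst hμν; simp
  unfold wgt
  refine Finset.prod_congr rfl fun κ _ => ?_
  simp only [Pi.add_apply, Pi.sub_apply, unitVec, Pi.one_apply]
  by_cases h1 : κ = μ
  · subst h1
    rw [role_nu (Ne.symm hμν), role_mu hμν, if_pos rfl, if_neg hμν]
    simp only [w1, if_true, sub_zero]
    split_ifs <;> first | rfl | omega
  · by_cases h2 : κ = ν
    · subst h2
      rw [role_mu (Ne.symm hμν), role_nu hμν, if_neg h1, if_pos rfl]
      simp only [w1, if_true, zero_sub]
      split_ifs <;> first | rfl | omega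
    · have hr1 : role ν μ κ = Role.gen := by simp [role, Ne.symm hμν, h1, h2]
      have hr2 : role μ ν κ = Role.gen := by simp [role, hμν, h1, h2]
      rw [hr1, hr2, if_neg h1, if_neg h2, sub_zero, add_zero]

/-- `z^{e_ν − e_μ} = z_ν z_μ⁻¹` at points with non-zero coordinates. [folklore] -/
private theorem zpowv_unitVec_sub {w : Fin d → ℂ} (hw : ∀ κ, w κ ≠ 0) (μ ν : Fin d) :
    zpowv w (unitVec ν - unitVec μ) = w ν * (w μ)⁻¹ := by
  have h1 : (unitVec ν : Pt d) = fun κ => if κ = ν then (1 : ℤ) else 0 := rfl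
  have h2 : (-unitVec μ : Pt d) = fun κ => if κ = μ then (-1 : ℤ) else 0 := by
    funext κ; simp [unitVec]; split_ifs <;> simp
  rw [zpowv_sub hw, h1, h2, zpowv_single, zpowv_single, zpow_one, zpow_neg_one]

/-- **(5.28)** for the `g` of the paper, from (5.14) and the coefficient form of (5.19) at `ε = (−1,…,−1)` ((5.20)'s
source): `g_{μν}(z) = z_ν⁻¹ z_μ g_{νμ}(z)` at every point with non-zero coordinates (`z_ν | g_{νμ}`).
[cite: Balaban1987RG1, (5.28) p.295] -/
theorem eq528 (c : Fin d → Fin d → Pt d → ℂ) (hS : Sym514 c) {μ ν : Fin d} (h19 : Cov519 c μ ν (-1))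
    {w : Fin d → ℂ} (hw : ∀ κ, w κ ≠ 0) : gRep c μ ν w = (w ν)⁻¹ * w μ * gRep c ν μ w := by
  set t : Pt d := unitVec μ - unitVec ν with ht
  have hs : shiftPt μ ν (-1 : Fin d → ℤˣ) = -t := by
    funext κ
    simp only [shiftPt, Pi.neg_apply, ht, Pi.sub_apply, unitVec]
    by_cases h1 : κ = μ <;> by_cases h2 : κ = ν <;> simp [h1, h2] <;> split_ifs <;> omega
  have hcoef : ∀ y : Pt d, c ν μ (y + t) = c μ ν y := fun y => by
    rw [hS ν μ (y + t)]
    have := h19 (y + t)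
    rw [flipPt_neg_one, hs, add_neg_cancel_right] at this
    rw [this]
    simp
  have hμ0 : w μ ≠ 0 := hw μ
  have hν0 : w ν ≠ 0 := hw ν
  unfold gRep piece
  rw [← (Equiv.addRight t).tsum_eq (fun x => (wgt ν μ 1 x : ℂ) * (c ν μ x * zpowv w (-flipPt 1 x))),
    ← tsum_mul_left]
  refine tsum_congr fun y => ?_
  rw [Equiv.coe_addRight, ht, wgt_swap_shift, ← ht, hcoef, flipPt_one, flipPt_one, neg_add, zpowv_add hw,
    show -t = unitVec ν - unitVec μ by rw [ht, neg_sub], zpowv_unitVec_sub hw]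
  field_simp

/-- **(5.20)** for `f = (5.29)`, from (5.14): `f_{μν}(z) = f_{νμ}(z⁻¹)` at every point.
[cite: Balaban1987RG1, (5.20) p.294] -/
theorem eq520 (c : Fin d → Fin d → Pt d → ℂ) (hS : Sym514 c) (μ ν : Fin d) (z : Fin d → ℂ) :
    f529 c μ ν z = f529 c ν μ (fun κ => (z κ)⁻¹) := by
  unfold f529
  rw [← (Equiv.neg (Pt d)).tsum_eq (fun x => c ν μ x * zpowv (fun κ => (z κ)⁻¹) (-x))]
  refine tsum_congr fun x => ?_
  rw [Equiv.neg_apply, neg_neg, hS μ ν x, zpowv_neg_eq_inv]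

/-! ## §8. Reality: «all these terms, and in particular the function g_{μν}(z), are real functions for real
variables z» -/

/-- Every piece of a REAL kernel at a REAL point is the complexification of a real series.
[cite: Balaban1987RG1, (5.29) p.295] -/
theorem piece_ofReal (P : B12Beta.Kernel d) (μ ν : Fin d) (ε : Fin d → ℤˣ) (t : Fin d → ℝ) :
    piece (castK P) μ ν ε (fun κ => (t κ : ℂ))
      = ((∑' x, wgt μ ν ε x * (P μ ν x * ∏ κ, t κ ^ ((-flipPt ε x) κ)) : ℝ) : ℂ) := by
  unfold piece zpowv
  rw [Complex.ofReal_tsum]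
  refine tsum_congr fun x => ?_
  push_cast
  rfl

/-- **Reality of the pieces**: for a real kernel `Π` and real `z`, `g^ε_{μν}(z) ∈ ℝ`. [cite: Balaban1987RG1, (5.29) p.295] -/
theorem piece_im_eq_zero (P : B12Beta.Kernel d) (μ ν : Fin d) (ε : Fin d → ℤˣ) (t : Fin d → ℝ) :
    (piece (castK P) μ ν ε (fun κ => (t κ : ℂ))).im = 0 := by
  rw [piece_ofReal, Complex.ofReal_im]

/-- **«in particular the function g_{μν}(z)» is real for real `z`** (real kernel). [cite: Balaban1987RG1, (5.29) p.295] -/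
theorem gRep_im_eq_zero (P : B12Beta.Kernel d) (μ ν : Fin d) (t : Fin d → ℝ) :
    (gRep (castK P) μ ν (fun κ => (t κ : ℂ))).im = 0 :=
  piece_im_eq_zero P μ ν 1 t

end

end Literature.MathematicalPhysics.QuantumFieldTheory.Balaban1983to89.B12Rep526Coeff
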